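import Mathlib.Analysis.SpecialFunctions.Trigonometric.Basic
import Mathlib.Analysis.SpecialFunctions.Complex.Log

/-!
# The sine–Gaussian-binomial expansion (q-binomial theorem on the unit circle, centred form)

Framing: lottery ticket; floor = certified bounds/negative ranges. Venture `PackingBounds` (cell
`pub-packcert`, seat `pub-packcert-energy`) — the algebraic engine behind the universal optimality of the
regular `N`-gon for every `N` (Cohn–Kumar 2007, Table 1, first row): positive definiteness of the partial
products of the `N`-gon's inner products (Cohn–Kumar Thm. 3.1, here with EXPLICIT nonnegative coefficients).

With the sine factorials `F_x(n) = ∏_{i=1}^{n} sin(i x)` and the sine Gaussian binomials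
`S_x(n,r) = F_x(n) / (F_x(r) F_x(n-r))` (the absolute values of the Gaussian binomials `[n r]_q` at
`q = e^{2ix}`), for `0 < x` and `n x < π` (so that every `S_x(n,r) > 0`):

* `prod_eq`: `∏_{j<n} (z + e^{i(2j-n+1)x}) = Σ_{r ≤ n} S_x(n,r) z^{n-r}` for all `z ∈ ℂ` (q-binomial theorem,
  by the Pascal rule `S(n+1,r+1) = S(n,r+1) e^{i(r+1)x} + S(n,r) e^{-i(n-r)x}`, i.e. the sine addition formula);
* the cosine corollaries (prefix products of the `N`-gon nodes) are in `PolygonPrefixProducts.lean`.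

## References
* H. Cohn, A. Kumar, *Universally optimal distribution of points on spheres*, J. Amer. Math. Soc. 20 (2007)
  99–148, Thm. 3.1 and §5.2 (positive definiteness of the partial products), §8 (the `S¹` case). [`CohnKumar2006`]
* G. E. Andrews, *The Theory of Partitions*, Thm. 3.3 (q-binomial theorem). [folklore]
-/

noncomputable section

namespace Summit.Ventures.PackingBounds.Energy

open Finset

namespace SineBinomial

/-- The sine factorial `F_x(n) = ∏_{i=1}^{n} sin(i x)`. [folklore] -/
def sinFact (x : ℝ) (n : ℕ) : ℝ := ∏ i ∈ range n, Real.sin (((i : ℝ) + 1) * x)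

/-- The sine Gaussian binomial `S_x(n,r) = F_x(n) / (F_x(r) F_x(n-r))` (`0` for `r > n`). [folklore] -/
def sgauss (x : ℝ) (n r : ℕ) : ℝ :=
  if r ≤ n then sinFact x n / (sinFact x r * sinFact x (n - r)) else 0

/-- `F_x(0) = 1`. [folklore] -/
@[simp] theorem sinFact_zero (x : ℝ) : sinFact x 0 = 1 := by simp [sinFact]

/-- `F_x(n+1) = F_x(n) sin((n+1)x)`. [folklore] -/
theorem sinFact_succ (x : ℝ) (n : ℕ) :
    sinFact x (n + 1) = sinFact x n * Real.sin (((n : ℝ) + 1) * x) := by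
  simp [sinFact, Finset.prod_range_succ]

/-- `F_x(n) > 0` when `0 < x` and `n x < π`. [folklore] -/
theorem sinFact_pos {x : ℝ} (hx : 0 < x) {n : ℕ} (hn : (n : ℝ) * x < Real.pi) : 0 < sinFact x n := by
  unfold sinFact
  refine Finset.prod_pos fun i hi => Real.sin_pos_of_pos_of_lt_pi (by positivity) ?_
  have hi' : (i : ℝ) + 1 ≤ n := by exact_mod_cast Nat.succ_le_of_lt (Finset.mem_range.1 hi)
  nlinarith

/-- `S_x(n,r) = 0` for `r > n`. [folklore] -/
theorem sgauss_of_lt {x : ℝ} {n r : ℕ} (h : n < r) : sgauss x n r = 0 := by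
  simp [sgauss, not_le.mpr h]

/-- `S_x(n,r) ≥ 0` when `0 < x` and `n x < π`. [folklore] -/
theorem sgauss_nonneg {x : ℝ} (hx : 0 < x) {n : ℕ} (hn : (n : ℝ) * x < Real.pi) (r : ℕ) :
    0 ≤ sgauss x n r := by
  unfold sgauss
  split_ifs with h
  · have hr : (r : ℝ) * x < Real.pi :=
      lt_of_le_of_lt (mul_le_mul_of_nonneg_right (by exact_mod_cast h) hx.le) hn
    have hnr : ((n - r : ℕ) : ℝ) * x < Real.pi :=
      lt_of_le_of_lt (mul_le_mul_of_nonneg_right (by exact_mod_cast Nat.sub_le n r) hx.le) hn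
    exact div_nonneg (sinFact_pos hx hn).le (mul_pos (sinFact_pos hx hr) (sinFact_pos hx hnr)).le
  · exact le_rfl

/-- `S_x(n,0) = 1` (for `n x < π`). [folklore] -/
theorem sgauss_zero_right {x : ℝ} (hx : 0 < x) {n : ℕ} (hn : (n : ℝ) * x < Real.pi) : sgauss x n 0 = 1 := by
  unfold sgauss
  rw [if_pos (Nat.zero_le _), sinFact_zero, one_mul, Nat.sub_zero, div_self (sinFact_pos hx hn).ne']

/-- Symmetry `S_x(n,n-r) = S_x(n,r)`. [folklore] -/
theorem sgauss_symm (x : ℝ) {n r : ℕ} (h : r ≤ n) : sgauss x n (n - r) = sgauss x n r := by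
  unfold sgauss
  rw [if_pos (Nat.sub_le _ _), if_pos h, Nat.sub_sub_self h, mul_comm (sinFact x (n - r))]

/-- `S_x(n,n) = 1` (for `n x < π`). [folklore] -/
theorem sgauss_self {x : ℝ} (hx : 0 < x) {n : ℕ} (hn : (n : ℝ) * x < Real.pi) : sgauss x n n = 1 := by
  have h := sgauss_symm x (Nat.zero_le n)
  rw [Nat.sub_zero] at h
  rw [h, sgauss_zero_right hx hn]

/-- **The real Pascal rule** behind the q-binomial recurrence: with `n = r + d + 1`,
`S(n+1,r+1) = S(n,r+1) cos((r+1)x) + S(n,r) cos((d+1)x)` and `S(n,r+1) sin((r+1)x) = S(n,r) sin((d+1)x)`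
(both are the sine addition formula). [folklore] -/
theorem sgauss_pascal {x : ℝ} (hx : 0 < x) (r d : ℕ) (h : ((r + d + 2 : ℕ) : ℝ) * x < Real.pi) :
    sgauss x (r + d + 2) (r + 1) =
        sgauss x (r + d + 1) (r + 1) * Real.cos (((r : ℝ) + 1) * x) +
          sgauss x (r + d + 1) r * Real.cos (((d : ℝ) + 1) * x) ∧
      sgauss x (r + d + 1) (r + 1) * Real.sin (((r : ℝ) + 1) * x) =
        sgauss x (r + d + 1) r * Real.sin (((d : ℝ) + 1) * x) := by
  have hlt : ∀ m : ℕ, m ≤ r + d + 2 → (m : ℝ) * x < Real.pi := fun m hm =>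
    lt_of_le_of_lt (mul_le_mul_of_nonneg_right (by exact_mod_cast hm) hx.le) h
  have hFn := (sinFact_pos hx (hlt (r + d + 1) (by omega))).ne'
  have hFr := (sinFact_pos hx (hlt r (by omega))).ne'
  have hFd := (sinFact_pos hx (hlt d (by omega))).ne'
  have hs : ∀ m : ℕ, m + 1 ≤ r + d + 2 → Real.sin (((m : ℝ) + 1) * x) ≠ 0 := fun m hm =>
    (Real.sin_pos_of_pos_of_lt_pi (by positivity) (by
      have := hlt (m + 1) hm; push_cast at this; linarith)).ne'
  have hsr := hs r (by omega)
  have hsd := hs d (by omega)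
  have hadd : Real.sin ((((r + d + 1 : ℕ) : ℝ) + 1) * x) =
      Real.sin (((d : ℝ) + 1) * x) * Real.cos (((r : ℝ) + 1) * x) +
        Real.cos (((d : ℝ) + 1) * x) * Real.sin (((r : ℝ) + 1) * x) := by
    rw [← Real.sin_add]; push_cast; ring_nf
  unfold sgauss
  rw [if_pos (by omega), if_pos (by omega), if_pos (by omega),
    show r + d + 2 - (r + 1) = d + 1 by omega, show r + d + 1 - (r + 1) = d by omega,
    show r + d + 1 - r = d + 1 by omega, show r + d + 2 = (r + d + 1) + 1 by omega,
    sinFact_succ x (r + d + 1), sinFact_succ x r, sinFact_succ x d, hadd]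
  set a := Real.sin (((r : ℝ) + 1) * x)
  set b := Real.sin (((d : ℝ) + 1) * x)
  set ca := Real.cos (((r : ℝ) + 1) * x)
  set cb := Real.cos (((d : ℝ) + 1) * x)
  constructor
  · field_simp
  · field_simp

/-- The Pascal rule in complex form: `S(n+1,r+1) = S(n,r+1) e^{i(r+1)x} + S(n,r) e^{-i(d+1)x}`, `n = r+d+1`.
[folklore] -/
theorem sgauss_pascal_complex {x : ℝ} (hx : 0 < x) (r d : ℕ) (h : ((r + d + 2 : ℕ) : ℝ) * x < Real.pi) :
    (sgauss x (r + d + 2) (r + 1) : ℂ) =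
      sgauss x (r + d + 1) (r + 1) * Complex.exp (↑(((r : ℝ) + 1) * x) * Complex.I) +
        sgauss x (r + d + 1) r * Complex.exp (↑(-(((d : ℝ) + 1) * x)) * Complex.I) := by
  obtain ⟨ha, hb⟩ := sgauss_pascal hx r d h
  have ha' := congrArg (fun t : ℝ => (t : ℂ)) ha
  have hb' := congrArg (fun t : ℝ => (t : ℂ)) hb
  push_cast at ha' hb'
  rw [Complex.exp_mul_I, Complex.exp_mul_I, ← Complex.ofReal_cos, ← Complex.ofReal_sin, ← Complex.ofReal_cos,
    ← Complex.ofReal_sin, Real.cos_neg, Real.sin_neg]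
  push_cast
  linear_combination ha' - Complex.I * hb'

/-- One multiplication by a linear factor on a coefficient list: if `g_{n+1} = 0` then
`(Σ_{r ≤ n} g_r z^{n-r}) (z + b) = Σ_{r ≤ n+1} (g_r + b g_{r-1}) z^{n+1-r}` (`g_{-1} = 0`). [folklore] -/
theorem sum_mul_linear (g : ℕ → ℂ) (n : ℕ) (hg : g (n + 1) = 0) (z b : ℂ) :
    (∑ r ∈ range (n + 1), g r * z ^ (n - r)) * (z + b) =
      ∑ r ∈ range (n + 2), (g r + b * (if r = 0 then 0 else g (r - 1))) * z ^ (n + 1 - r) := by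
  have h1 : (∑ r ∈ range (n + 1), g r * z ^ (n - r)) * z = ∑ r ∈ range (n + 2), g r * z ^ (n + 1 - r) := by
    rw [Finset.sum_range_succ _ (n + 1), hg, zero_mul, add_zero, Finset.sum_mul]
    refine Finset.sum_congr rfl fun r hr => ?_
    have hr' : r ≤ n := Nat.lt_succ_iff.mp (Finset.mem_range.mp hr)
    rw [show n + 1 - r = (n - r) + 1 by omega, pow_succ]; ring
  have h2 : (∑ r ∈ range (n + 1), g r * z ^ (n - r)) * b =
      ∑ r ∈ range (n + 2), (b * (if r = 0 then 0 else g (r - 1))) * z ^ (n + 1 - r) := by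
    rw [Finset.sum_range_succ' _ (n + 1)]
    simp only [if_true, mul_zero, zero_mul, add_zero, Nat.succ_ne_zero, if_false, Nat.add_sub_cancel,
      Finset.sum_mul]
    refine Finset.sum_congr rfl fun r _ => ?_
    rw [show n + 1 - (r + 1) = n - r by omega]; ring
  rw [mul_add, h1, h2, ← Finset.sum_add_distrib]
  exact Finset.sum_congr rfl fun r _ => by ring

/-- **The centred q-binomial theorem on the unit circle**: for `0 < x`, `n x < π` and every `z ∈ ℂ`,
`∏_{j<n} (z + e^{i(2j-n+1)x}) = Σ_{r ≤ n} S_x(n,r) z^{n-r}`. [folklore] -/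
theorem prod_eq {x : ℝ} (hx : 0 < x) :
    ∀ n : ℕ, (n : ℝ) * x < Real.pi → ∀ z : ℂ,
      ∏ j ∈ range n, (z + Complex.exp (↑((2 * (j : ℝ) - n + 1) * x) * Complex.I)) =
        ∑ r ∈ range (n + 1), (sgauss x n r : ℂ) * z ^ (n - r) := by
  intro n
  induction n with
  | zero =>
    intro _ z
    simp [sgauss]
  | succ n ih =>
    intro hn z
    have hn' : (n : ℝ) * x < Real.pi := by push_cast at hn; nlinarith
    set w : ℂ := Complex.exp (↑x * Complex.I) with hw
    have hw0 : w ≠ 0 := Complex.exp_ne_zero _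
    -- shift: factor `j+1` of level `n+1` is `w · (factor j of level n at z/w)`
    have hshift : ∀ j : ℕ, z + Complex.exp (↑((2 * ((j + 1 : ℕ) : ℝ) - (n + 1 : ℕ) + 1) * x) * Complex.I) =
        w * (z * w⁻¹ + Complex.exp (↑((2 * (j : ℝ) - n + 1) * x) * Complex.I)) := by
      intro j
      rw [mul_add, ← mul_assoc, mul_comm w z, mul_assoc, mul_inv_cancel₀ hw0, mul_one, hw,
        ← Complex.exp_add]
      congr 2
      push_cast; ring
    have h0 : Complex.exp (↑((2 * ((0 : ℕ) : ℝ) - (n + 1 : ℕ) + 1) * x) * Complex.I) = (w⁻¹) ^ n := by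
      rw [hw, ← Complex.exp_neg, ← Complex.exp_nat_mul]
      congr 1
      push_cast; ring
    rw [Finset.prod_range_succ', Finset.prod_congr rfl fun j _ => hshift j, Finset.prod_mul_distrib,
      Finset.prod_const, Finset.card_range, ih hn' (z * w⁻¹), h0]
    -- rewrite `w^n Σ S(n,r) (z/w)^{n-r}` as `Σ (S(n,r) w^r) z^{n-r}`
    have hpow : ∀ r ∈ range (n + 1), w ^ n * ((sgauss x n r : ℂ) * (z * w⁻¹) ^ (n - r)) =
        ((sgauss x n r : ℂ) * w ^ r) * z ^ (n - r) := by
      intro r hr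
      have hr' : r ≤ n := Nat.lt_succ_iff.mp (Finset.mem_range.mp hr)
      obtain ⟨e, rfl⟩ : ∃ e, n = r + e := ⟨n - r, by omega⟩
      rw [Nat.add_sub_cancel_left, mul_pow, pow_add]
      have : w ^ e * w⁻¹ ^ e = 1 := by rw [← mul_pow, mul_inv_cancel₀ hw0, one_pow]
      linear_combination ((sgauss x (r + e) r : ℂ) * w ^ r * z ^ e) * this
    rw [Finset.mul_sum, Finset.sum_congr rfl hpow,
      sum_mul_linear (fun r => (sgauss x n r : ℂ) * w ^ r) n (by
        simp [sgauss_of_lt (Nat.lt_succ_self n)]) z ((w⁻¹) ^ n)]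
    rw [show n + 1 + 1 = n + 2 by rfl]
    refine Finset.sum_congr rfl fun r hr => ?_
    congr 1
    -- the coefficient identity: Pascal rule
    rcases r with _ | r
    · simp [sgauss_zero_right hx hn', sgauss_zero_right hx hn]
    · simp only [Nat.succ_ne_zero, if_false, Nat.add_sub_cancel]
      have hr' : r ≤ n := by
        have := Finset.mem_range.mp hr; omega
      rcases Nat.lt_or_eq_of_le hr' with hlt | rfl
      · -- genuine Pascal step with `n = r + d + 1`
        obtain ⟨d, rfl⟩ : ∃ d, n = r + d + 1 := ⟨n - r - 1, by omega⟩
        have hwr : w ^ (r + 1) = Complex.exp (↑(((r : ℝ) + 1) * x) * Complex.I) := by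
          rw [hw, ← Complex.exp_nat_mul]; congr 1; push_cast; ring
        have hwd : (w⁻¹) ^ (r + d + 1) * w ^ r = Complex.exp (↑(-(((d : ℝ) + 1) * x)) * Complex.I) := by
          rw [hw, ← Complex.exp_neg, ← Complex.exp_nat_mul, ← Complex.exp_nat_mul, ← Complex.exp_add]
          congr 1; push_cast; ring
        rw [show r + d + 1 + 1 = r + d + 2 by ring, sgauss_pascal_complex hx r d (by
          push_cast at hn ⊢; linarith), ← hwr, ← hwd]
        ring
      · -- top coefficient: `S(r+2, r+1)·1 = S(r+1,r+1) w^{r+1} + w^{-(r+1)} S(r+1,r) w^r`? no: here `r = n`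
        rw [sgauss_of_lt (Nat.lt_succ_self _), sgauss_self hx hn', sgauss_self hx hn]
        push_cast
        rw [zero_mul, zero_add, one_mul, ← mul_pow, inv_mul_cancel₀ hw0, one_pow]

end SineBinomial

end Summit.Ventures.PackingBounds.Energy

end
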